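import Summits.HodgeConjecture.CorCM.Census.MultiFieldWeilDefect
import Summits.HodgeConjecture.CorCM.Census.SexticDecicWeilDefect
import Mathlib.Data.Fin.VecNotation
import HarnessLib

/-!
# `E × B₄ × B₅` over an octic and a decic CM field sharing `k` (degrees `8 + 10`) THROUGH THE MULTI-FIELD WEIL ENGINE: the data of the generic
# model and THE DEFECT LAW `d₂ ≡ t₂, d₃ ≡ t₃, e = 2t₂ + t₃` from a realised ROTATION of the five decic pairs and TRANSITIVITY on the four octic pairs

COR-CM (cell `pub-hodgecm2`), seat b30 gen 28 (2026-08-23); count-neutral own lane (stem `OcticDecicWeil*`), the two-field `(8,10)` instance of the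
MULTI-FIELD WEIL ENGINE (`Census/MultiFieldWeil{,Defect}`) — a three-file replacement of the eleven-file chain `Census/OcticDecicWeil{Parts,
PartsBalanced,Extraction}` + `CorCM/OcticDecicWeil{FrameTransfer,…,HodgeOfMarkman}` of gen 27 (same headline, namespace `OcticDecicWeilG`).
Theorems of the finite model plus bookkeeping definitions (`n2`, `np2`, `c2`, `w2`, `P2`, the concrete casts `oc2`, `dc2`, `withDc2`, `rd0₂`,
`rd1₂`); no named fact, no geometry, no `sorry`.

THE INSTANCE.  `r = 2` fields: `K₂` octic (`n = 4` pairs, `k`-signature `(1,3)` read at `{0}`, `c = 2`, `w = 3`: the SIXFOLD `B₄ × E × E`), `K₃`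
decic (`n = 5`, `(2,3)` at `{0,1}`, `c = 1`, `w = 3`: the SIXFOLD `B₅ × E`).  THE ARGUMENT = gen 27ʼs `Census/OcticDecicWeilDefect` in the generic
model: (i) rotation-stability of the decic component (`hrot`) forces `d₃ ≡ t₃` (`SexticDecicWeil.const_of_pairSums`) and a decic part `−t₃`;
(ii) transitivity on the octic pairs (`ht`) then gives `d₂ ≡ t₂` and `e = 4t₂ − 2t₂ + t₃ = 2t₂ + t₃ = Σ_m c_m t_m`.
[cite: Pohlmann1968, Thm 1] [cite: GaoUllmo2025, Thm 3.1] [cite: MoonenZarhin1995Duke, Thm. 2.4] [cite: DixonMortimer1996, §2.1]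

## References
* [Pohlmann1968] H. Pohlmann, Ann. of Math. 88 (1968), Thm 1.  [GaoUllmo2025] Z. Gao, E. Ullmo, J. Inst. Math. Jussieu 25 (2025),
  Thm 3.1.  [MoonenZarhin1995Duke] B. Moonen, Yu. Zarhin, Duke Math. J. 77 (1995), Thm. 2.4.  [DixonMortimer1996] J. D. Dixon,
  B. Mortimer, *Permutation Groups*, GTM 163, §2.1.
-/

namespace Summit.HodgeConjecture.CorCM.Census.OcticDecicWeilG

open Finset
open Summit.HodgeConjecture.CorCM.Census.MultiFieldWeil
open Summit.HodgeConjecture.CorCM.Census.SexticOcticWeil (sum_ite_perm_eq)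
open Summit.HodgeConjecture.CorCM.Census.SexticDecicWeil (sum_ite_pair_eq const_of_pairSums sum_ite_rot_pow_eq)

/-! ### The data of the instance -/

/-- Numbers of conjugate pairs: `4, 5` (octic, decic). [folklore] -/
def n2 : Fin 2 → ℕ := ![4, 5]

/-- Numbers of positions over `τ`: `1, 2` (`k`-signatures `(1,3)`, `(2,3)`). [folklore] -/
def np2 : Fin 2 → ℕ := ![1, 2]

/-- Curve multiplicities `c_m = n_m − 2 p_m`: `2, 1`. [folklore] -/
def c2 : Fin 2 → ℕ := ![2, 1]

/-- Part sizes `w_m = n_m − p_m`: `3, 3` (the sixfolds `B₄ × E²`, `B₅ × E`). [folklore] -/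
def w2 : Fin 2 → ℕ := ![3, 3]

/-- The position sets: the first `np2 m` positions. [folklore] -/
def P2 : ∀ m : Fin 2, Finset (Fin (n2 m)) := fun m => lowPos (n2 m) (np2 m)

/-- `|P2 m| = np2 m`. [folklore] -/
theorem card_P2 (m : Fin 2) : (P2 m).card = np2 m := by
  refine Fin.cases ?_ (fun m => Fin.cases ?_ (fun m => m.elim0) m) m
  · exact card_lowPos (by decide)
  · exact card_lowPos (by decide)

/-- `n_m = 2 p_m + c_m`. [folklore] -/
theorem n2_eq (m : Fin 2) : (n2 m : ℤ) = 2 * (P2 m).card + c2 m := by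
  rw [card_P2]
  refine Fin.cases ?_ (fun m => Fin.cases ?_ (fun m => m.elim0) m) m <;> rfl

/-- `n_m + c_m = 2 w_m`. [folklore] -/
theorem n2_add_c2 (m : Fin 2) : n2 m + c2 m = 2 * w2 m := by
  refine Fin.cases ?_ (fun m => Fin.cases ?_ (fun m => m.elim0) m) m <;> rfl

/-- `c_m < n_m`. [folklore] -/
theorem c2_lt_n2 (m : Fin 2) : c2 m < n2 m := by
  refine Fin.cases ?_ (fun m => Fin.cases ?_ (fun m => m.elim0) m) m <;> decide

/-! ### Reading the tuples and the defects in concrete types -/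

/-- The octic component of a tuple, as a permutation of `Fin 4`. [folklore] -/
def oc2 (π : PermsG n2) : Equiv.Perm (Fin 4) := π 0

/-- The decic component of a tuple, as a permutation of `Fin 5`. [folklore] -/
def dc2 (π : PermsG n2) : Equiv.Perm (Fin 5) := π 1

/-- Replacing the decic component of a tuple. [folklore] -/
def withDc2 (π : PermsG n2) (σ : Equiv.Perm (Fin 5)) : PermsG n2 := Function.update π 1 σ

/-- `oc2` is unchanged by `withDc2`. [folklore] -/
@[simp] theorem oc2_withDc2 (π : PermsG n2) (σ : Equiv.Perm (Fin 5)) : oc2 (withDc2 π σ) = oc2 π := by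
  unfold oc2 withDc2
  exact Function.update_of_ne (by decide) _ _

/-- `dc2 (withDc2 π σ) = σ`. [folklore] -/
@[simp] theorem dc2_withDc2 (π : PermsG n2) (σ : Equiv.Perm (Fin 5)) : dc2 (withDc2 π σ) = σ := by
  show Function.update π 1 _ 1 = _
  exact Function.update_self _ _ _

/-- `withDc2 π (dc2 π) = π`. [folklore] -/
@[simp] theorem withDc2_dc2 (π : PermsG n2) : withDc2 π (dc2 π) = π := by
  show Function.update π 1 (π 1) = π
  exact Function.update_eq_self _ _

/-- `withDc2 (withDc2 π σ) σ' = withDc2 π σ'`. [folklore] -/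
@[simp] theorem withDc2_withDc2 (π : PermsG n2) (σ σ' : Equiv.Perm (Fin 5)) : withDc2 (withDc2 π σ) σ' = withDc2 π σ' := by
  show Function.update (Function.update π 1 _) 1 _ = Function.update π 1 _
  exact Function.update_idem _ _ _

/-- The octic defects, as a function on `Fin 4`. [folklore] -/
def rd0₂ (d : ∀ m : Fin 2, Fin (n2 m) → ℤ) : Fin 4 → ℤ := d 0

/-- The decic defects, as a function on `Fin 5`. [folklore] -/
def rd1₂ (d : ∀ m : Fin 2, Fin (n2 m) → ℤ) : Fin 5 → ℤ := d 1

/-- **The double sum of the signed equation, read in concrete types**: the conditions are `oc2 π a = 0`, `dc2 π b ∈ {0, 1}`. [folklore] -/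
theorem sum2_eq (π : PermsG n2) (d : ∀ m : Fin 2, Fin (n2 m) → ℤ) :
    (∑ m : Fin 2, ∑ a : Fin (n2 m), (if π m a ∈ P2 m then d m a else -d m a)) =
      (∑ a : Fin 4, (if oc2 π a = 0 then rd0₂ d a else -rd0₂ d a)) +
        ∑ b : Fin 5, (if (dc2 π b = 0 ∨ dc2 π b = 1) then rd1₂ d b else -rd1₂ d b) := by
  rw [Fin.sum_univ_two]
  have h0 : (∑ a : Fin (n2 0), (if π 0 a ∈ P2 0 then d 0 a else -d 0 a)) = ∑ a : Fin 4, (if oc2 π a = 0 then rd0₂ d a else -rd0₂ d a) := by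
    show (∑ a : Fin 4, (if oc2 π a ∈ lowPos 4 1 then rd0₂ d a else -rd0₂ d a)) = _
    exact Finset.sum_congr rfl fun a _ => if_congr mem_lowPos_one rfl rfl
  have h1 : (∑ a : Fin (n2 1), (if π 1 a ∈ P2 1 then d 1 a else -d 1 a)) =
      ∑ b : Fin 5, (if (dc2 π b = 0 ∨ dc2 π b = 1) then rd1₂ d b else -rd1₂ d b) := by
    show (∑ b : Fin 5, (if dc2 π b ∈ lowPos 5 2 then rd1₂ d b else -rd1₂ d b)) = _
    exact Finset.sum_congr rfl fun a _ => if_congr mem_lowPos_two rfl rfl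
  rw [h0, h1]

/-! ### The defect law -/

section Defect

variable {R : Finset (PermsG n2)}

/-- Rotation-stability iterates: `(π₂, π₃ ρʲ) ∈ R` for all `j`. [folklore] -/
theorem mem_of_rot2 (g : Equiv.Perm (Fin 5)) (hrot : ∀ π ∈ R, withDc2 π (dc2 π * (g * finRotate 5 * g⁻¹)) ∈ R)
    {π : PermsG n2} (hπ : π ∈ R) (j : ℕ) : withDc2 π (dc2 π * (g * finRotate 5 * g⁻¹) ^ j) ∈ R := by
  induction j with
  | zero =>
    rw [pow_zero, mul_one, withDc2_dc2]
    exact hπ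
  | succ j ih =>
    have h := hrot _ ih
    rw [dc2_withDc2, withDc2_withDc2, mul_assoc, ← pow_succ] at h
    exact h

/-- **THE DEFECT LAW (integer form) for two fields `8 + 10`.**  If `e` and `d` satisfy the signed equation at every tuple of a set `R` that is stable
under right translation of the decic component by a conjugate rotation (`hrot`) and moves every octic pair to `0` (`ht`), then `d_m ≡ t_m` are
constant and `e = 2t₂ + t₃`. [cite: MoonenZarhin1995Duke, Thm. 2.4] [cite: GaoUllmo2025, Thm 3.1] -/
theorem defect2_of_signed (g : Equiv.Perm (Fin 5)) (hrot : ∀ π ∈ R, withDc2 π (dc2 π * (g * finRotate 5 * g⁻¹)) ∈ R)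
    (ht : ∀ y : Fin 4, ∃ π ∈ R, oc2 π y = 0) {e : ℤ} {d : ∀ m : Fin 2, Fin (n2 m) → ℤ}
    (h : ∀ π ∈ R, e + ∑ m : Fin 2, ∑ a : Fin (n2 m), (if π m a ∈ P2 m then d m a else -d m a) = 0) :
    ∃ t : Fin 2 → ℤ, (∀ (m : Fin 2) (a : Fin (n2 m)), d m a = t m) ∧ e = ∑ m : Fin 2, (c2 m : ℤ) * t m := by
  set d₂ : Fin 4 → ℤ := rd0₂ d with hd₂
  set d₃ : Fin 5 → ℤ := rd1₂ d with hd₃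
  have h' : ∀ π ∈ R, e + ((∑ a : Fin 4, (if oc2 π a = 0 then d₂ a else -d₂ a)) +
      ∑ b : Fin 5, (if (dc2 π b = 0 ∨ dc2 π b = 1) then d₃ b else -d₃ b)) = 0 := by
    intro π hπ
    have h1 := h π hπ
    rw [sum2_eq] at h1
    exact h1
  obtain ⟨π₀, hπ₀, -⟩ := ht 0
  set π₃ : Equiv.Perm (Fin 5) := dc2 π₀ with hπ₃
  set u : Fin 5 → ℤ := fun c => d₃ (g c) with hu
  have hp : (π₃ * g) ((π₃ * g).symm 0) = 0 := (π₃ * g).apply_symm_apply 0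
  have hq : (π₃ * g) ((π₃ * g).symm 1) = 1 := (π₃ * g).apply_symm_apply 1
  have hpq : (π₃ * g).symm 0 ≠ (π₃ * g).symm 1 := fun hh => by
    have h'' := congrArg (π₃ * g) hh
    rw [hp, hq] at h''
    exact absurd h'' (by decide)
  have hrotj : ∀ j : Fin 5, e + ((∑ a : Fin 4, (if oc2 π₀ a = 0 then d₂ a else -d₂ a)) +
      ∑ b : Fin 5, (if ((π₃ * (g * finRotate 5 * g⁻¹) ^ (j : ℕ)) b = 0 ∨ (π₃ * (g * finRotate 5 * g⁻¹) ^ (j : ℕ)) b = 1)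
        then d₃ b else -d₃ b)) = 0 := by
    intro j
    have h1 := h' _ (mem_of_rot2 g hrot hπ₀ (j : ℕ))
    rw [oc2_withDc2, dc2_withDc2] at h1
    exact h1
  have hS : ∀ j : Fin 5, u ((π₃ * g).symm 0 - j) + u ((π₃ * g).symm 1 - j) = u ((π₃ * g).symm 0) + u ((π₃ * g).symm 1) := by
    intro j
    have h0 := hrotj 0
    have hj := hrotj j
    rw [sum_ite_rot_pow_eq π₃ g d₃ 0 hp hq, sub_zero, sub_zero] at h0
    rw [sum_ite_rot_pow_eq π₃ g d₃ j hp hq] at hj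
    simp only [hu]
    linarith
  have huc : ∀ c, u c = u ((π₃ * g).symm 0) := const_of_pairSums hpq hS
  set t₃ : ℤ := d₃ (g ((π₃ * g).symm 0)) with ht₃
  have hd₃c : ∀ b, d₃ b = t₃ := fun b => by
    have h1 := huc (g.symm b)
    simp only [hu, Equiv.apply_symm_apply] at h1
    exact h1
  have hB : ∀ σ : Equiv.Perm (Fin 5), (∑ b : Fin 5, (if (σ b = 0 ∨ σ b = 1) then d₃ b else -d₃ b)) = -t₃ := by
    intro σ
    rw [sum_ite_pair_eq σ (σ.apply_symm_apply 0) (σ.apply_symm_apply 1) d₃, Finset.sum_congr rfl fun b _ => hd₃c b,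
      hd₃c (σ.symm 0), hd₃c (σ.symm 1), Finset.sum_const, Finset.card_univ, Fintype.card_fin]
    ring
  have heq : ∀ y : Fin 4, e + (2 * d₂ y - ∑ a, d₂ a) - t₃ = 0 := by
    intro y
    obtain ⟨π, hπ, hy⟩ := ht y
    have h1 := h' π hπ
    rw [sum_ite_perm_eq (oc2 π) hy d₂, hB (dc2 π)] at h1
    linarith
  have hd₂c : ∀ a, d₂ a = d₂ 0 := fun a => by have h1 := heq a; have h2 := heq 0; linarith
  refine ⟨![d₂ 0, t₃], fun m => ?_, ?_⟩
  · refine Fin.cases ?_ (fun m => Fin.cases ?_ (fun m => m.elim0) m) m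
    · exact fun a => hd₂c a
    · exact fun a => hd₃c a
  · have hs₂ : ∑ a, d₂ a = 4 * d₂ 0 := by
      rw [Finset.sum_congr rfl fun a _ => hd₂c a, Finset.sum_const, Finset.card_univ, Fintype.card_fin]; ring
    have h3 := heq 0
    rw [hs₂] at h3
    rw [Fin.sum_univ_two]
    show e = ((2 : ℕ) : ℤ) * d₂ 0 + ((1 : ℕ) : ℤ) * t₃
    push_cast
    linarith

end Defect

/-! ### The defect law for configurations -/

section Config

variable {α : Type*} {R : Finset (PermsG n2)} {v : α → PtG n2}

/-- **THE DEFECT LAW FOR CONFIGURATIONS (two fields `8 + 10`).**  An `R`-balanced configuration, `R` rotation-stable on the decic pairs and transitive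
on the octic pairs, obeys the defect law of the generic model with curve multiplicities `c2 = (2, 1)` — the hypothesis `hdef` of
`MultiFieldWeil.hodgeConjectureFor_biproduct_comp_of_defectLawG`. [cite: MoonenZarhin1995Duke, Thm. 2.4] [cite: GaoUllmo2025, Thm 3.1] -/
theorem exists_hasDefectsG_of_modelBalancedG2 (g : Equiv.Perm (Fin 5))
    (hrot : ∀ π ∈ R, withDc2 π (dc2 π * (g * finRotate 5 * g⁻¹)) ∈ R) (ht : ∀ y : Fin 4, ∃ π ∈ R, oc2 π y = 0)
    {T : Finset α} (hT : ModelBalancedG P2 R v T) : ∃ t : Fin 2 → ℤ, HasDefectsG c2 v T t := by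
  obtain ⟨t, hd, he⟩ := defect2_of_signed g hrot ht (e := (cnt v T (Sum.inl true) : ℤ) - cnt v T (Sum.inl false))
    (d := fun m a => (cnt v T (Sum.inr ⟨m, (a, true)⟩) : ℤ) - cnt v T (Sum.inr ⟨m, (a, false)⟩))
    fun π hπ => signed_of_modelBalancedG R v hT hπ
  exact ⟨t, fun m a => hd m a, he⟩

end Config

end Summit.HodgeConjecture.CorCM.Census.OcticDecicWeilG
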